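import Summits.HubbardSuperconductivity.HubbardSuperconductivity.Theorems.AnisotropyChordTransferFibre3FinXDCheck

/-!
# Route `AnisotropyChord` / H0 rotor rung: FIN per-`L` row-D (KT-2a″) SUB-CELL facts, `L = 12` (0–4)

Row-D facts `xdCellAny0 12 (49/50) la lb aD = true` on quarter sub-cells of the combined cells whose side condition needs `aD ≈ .04` (mechhunt STATUS p3 g7 REPORT 3).
Prover seat `hubbard-h0-rotor-p3` g7; helper for piece A = stmt-HubbardSuperconductivity-23918 of rung 19089 (`--supports`, helper class).
WHAT THIS IS NOT: nothing here proves superconductivity in the Hubbard model (rotor TARGET as worded stays FALSE, g15 verdict); kernel facts /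
assembly for ONE conditional reduction at one `L`.  No sorry.
-/

set_option linter.dupNamespace false
set_option autoImplicit false

namespace Summit.HubbardSuperconductivity.HubbardSuperconductivity.Theorems.AnisotropyChord.Transfer.Fibre3

namespace FinXD

/-- row-D sub-cell `[12878646041447743, 12959137579206791]` of `L = 12`. [folklore] -/
theorem xd12s_141_0 : xdCellAny0 12 (49/50 : ℚ) 12878646041447743 12959137579206791 (1/25 : ℚ) = true := by decide +kernel

/-- row-D sub-cell `[12959137579206791, 13039629116965840]` of `L = 12`. [folklore] -/
theorem xd12s_141_1 : xdCellAny0 12 (49/50 : ℚ) 12959137579206791 13039629116965840 (1/25 : ℚ) = true := by decide +kernel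

/-- row-D sub-cell `[13039629116965840, 13120120654724888]` of `L = 12`. [folklore] -/
theorem xd12s_141_2 : xdCellAny0 12 (49/50 : ℚ) 13039629116965840 13120120654724888 (1/25 : ℚ) = true := by decide +kernel

/-- row-D sub-cell `[13120120654724888, 13200612192483937]` of `L = 12`. [folklore] -/
theorem xd12s_141_3 : xdCellAny0 12 (49/50 : ℚ) 13120120654724888 13200612192483937 (1/25 : ℚ) = true := by decide +kernel

/-- row-D sub-cell `[13200612192483937, 13283116018686961]` of `L = 12`. [folklore] -/
theorem xd12s_142_0 : xdCellAny0 12 (49/50 : ℚ) 13200612192483937 13283116018686961 (1/25 : ℚ) = true := by decide +kernel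

end FinXD

end Summit.HubbardSuperconductivity.HubbardSuperconductivity.Theorems.AnisotropyChord.Transfer.Fibre3
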